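import Literature.Computability.QuantumComplexity.PauliRotationWordMixing
import HarnessLib

/-!
# Letter laws of Clifford-angle rotation words: exact Pauli mixing is all-or-nothing in the depth

OBJECT.  Fix `n` wires (`ι`) and a finite LETTER FAMILY `P : κ → (ι → Pauli)` (repetitions allowed: a finitely
supported rational letter law).  The i.i.d. rotation-word ensemble of depth `L` is the family of Clifford unitaries
`R_{P(w₀)}(π/2) ⋯ R_{P(w_{L−1})}(π/2)` indexed by `w : Fin L → κ` (`lwordU P L w`, built from `RotationWords.wordU`
of `PauliRotationWordMixing`), carrying each Pauli label `T` to one label `lwalk P L w T` (`RotationWords.walk`).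
«Exactly Clifford–Pauli mixing at depth `L`» is the tree's interface `IsCliffordMixingLayer (lwordU P L) (lwalk P L)`
(`PauliMixingWitness`): every pair of non-identity labels `S, T` is joined by exactly `|κ|^L / (4ⁿ − 1)` words.

LEVER (elementary, [folklore] in substance: a reversible chain whose `L`-step law is exactly stationary is stationary
after ONE step).  One Clifford-angle letter `a` acts on labels by `cliffStep a` (`WeightTruncationTransientFloor`),
which is an INVOLUTION (`cliffStep_cliffStep`): a label moved to `a·U` still anticommutes with `a` and is moved
back.  Hence the one-step count `lstep P U S = #{k : cliffStep (P k) U = S}` is SYMMETRIC in `(U, S)` for every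
family `P`, has constant row sums `|κ|`, and never touches the identity label.  On the `N = 4ⁿ − 1` non-identity
labels write the kernel as `K = D + c·J` (`kernel`, `defect`, `ones`; `c = |κ|/N`, `J` all ones, `DJ = JD = 0`):
the cross terms die, `K^{L+1} = D^{L+1} + (|κ|^{L+1}/N)·J` (`kernel_pow_succ`), and the `(L+1)`-step word count
is the matrix power (`kernel_pow_apply`).  So «exact at depth `L + 1`» ⟺ `D^{L+1} = 0` ⟺ (`D` real symmetric,
trace-of-square descent `eq_zero_of_transpose_eq_of_pow_eq_zero`) `D = 0` ⟺ «exact at depth `1`»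
(`isCliffordMixingLayer_iff_depth_one`, `isCliffordMixingLayer_one_iff`).

RECORDS.
* `cliffStep_cliffStep`, `lstep_comm`, `lstep_eq_zero_of_comm` — involution, symmetry, and the zero at a commuting
  pair of distinct labels;
* `kernel_pow_apply` — `(K^L)_{U S} = lcount P L U S` for every `L` (at `L = 0`: `K⁰ = 1` = the empty word);
* `isCliffordMixingLayer_iff_lcount`, `isCliffordMixingLayer_iff_depth_one`, `isCliffordMixingLayer_one_iff` —
  the interface at depth `L + 1` ⟺ flat kernel power ⟺ flat kernel ⟺ the interface at depth `1`;
* `not_isCliffordMixingLayer_letterWords` — on `n ≥ 2` wires NO letter family and NO depth (incl. `L = 0`) is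
  exactly mixing: the commuting pair (`X` on wire `i₀`, `X` on wire `i₁`) has `lstep = 0 ≠ |κ|/N`; the permutation
  of the interface is forced to be the label walk (`perm_eq_lwalk`), so the same holds for every `π`
  (`not_isCliffordMixingLayer_letterWords_perm`);
* `nonIdLetters_isCliffordMixingLayer` — ONE wire: the three letters `{X, Y, Z}` (all non-identity strings) give
  an ensemble that IS exactly mixing at every depth `L + 1` (flat kernel `K = J`); `numbers_two` — two wires, the
  fifteen non-identity letters: `15 ∣ 15^{L+1}` (the divisibility test of `RotationWords.dvd_card_of_isCliffordMixingLayer`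
  is silent) and still not exact;  `words_not_isCliffordMixingLayer_of_one_lt` — `RotationWords.not_isCliffordMixingLayer_words`
  RECOVERED (not restated) for `n ≥ 2` by this second route.

PLACEMENT.  Third sub-clause of the rotation-word/exact-design question after `PauliRotationWordMixing`
(divisibility: `(4ⁿ − 1) ∤ 4^{nL}` for the UNIFORM letter law) and the two-mode law of `PauliRotationWordTwoMode`
(cited in prose only, not imported): here EVERY i.i.d. letter law, and the verdict does not depend on `|κ|` or `L`.

HONEST SCOPE / DISCLOSURES.  i.i.d. letters = ONE family `P` at every position; position-dependent families
(`P_j` varying with `j`) are NOT treated and nothing is claimed about them either way (a product of distinct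
symmetric kernels can annihilate the mean-zero space).  Angle `π/2` only.  «Exact» = the `equi` count of the
interface, relative error `0`; nothing here on approximate mixing rates beyond `PauliRotationWordMixing` BY NAME.
No operational / diamond-norm unitary-design statement, no state, no noise, no sampler, spoofer or test, no
hardness claim; the Clifford GROUP (the exact inhabitant on paper for `n ≥ 2`) is untouched.  The finite-depth
no-go is NOT the Clifford-group `t`-design classification of Zhu–Kueng–Grassl–Gross / Webb (those concern the full
group's moments, not i.i.d. words of a letter law at finite length).  Private plumbing re-derived rather than
imported: `stringMul_stringMul_self`, `strSign_self'`, `strSign_idStr_left'` (one-line letter tables, twins of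
private lemmas of `PauliRotationWordMixing`), `sum_nonId`, and the symmetric-nilpotent descent (twins NAMED at
`eq_zero_of_transpose_eq_of_pow_eq_zero`).  Nothing here proves or refutes quantum advantage.

NEAREST PRINT.  Reversible chains and their spectral form: [cite: LevinPeres2017, §12.1] [cite: LyonsPeres2016, §6.2
and proof of Theorem 13.13]; Pauli mixing (Definition 3): [cite: QuekEtAl2024, Methods §1.2]; Clifford-angle rotations map strings to
strings: [cite: BegusicGrayChan2024, Results §Sparse Pauli dynamics]; the one-step rule: [cite: RudolphEtAl2025,
§II B eq. (14)]; the Clifford group as the exact design on paper: [cite: ZhuEtAl2016, §1].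
-/

noncomputable section

open Matrix Finset Complex

namespace Literature.Computability.QuantumComplexity

namespace PauliMixingPurity.RotationWords.LetterLaw

open PauliPath PauliPropagation LocalScrambling.TransientFloor PauliMixingPurity.Witness PauliMixingPurity.Approx

variable {ι : Type*} [Fintype ι] [DecidableEq ι]
variable {κ : Type*} [Fintype κ]

/-! ## 1. Letter tables (private plumbing) -/

omit [Fintype ι] [DecidableEq ι] in
/-- `a · (a · U) = U` letterwise (the label group `𝔽₂^{2n}` has exponent two). [folklore] -/
private theorem stringMul_stringMul_self (a U : ι → Pauli) : stringMul a (stringMul a U) = U := by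
  funext i; simp only [stringMul]; cases a i <;> cases U i <;> rfl

omit [DecidableEq ι] in
/-- Every string commutes with itself: `κ(a, a) = 1`. [folklore] -/
private theorem strSign_self' (a : ι → Pauli) : strSign a a = 1 := by
  unfold strSign; exact Finset.prod_eq_one fun i _ => by cases a i <;> rfl

omit [DecidableEq ι] in
/-- The identity string commutes with everything: `κ(I, U) = 1`. [folklore] -/
private theorem strSign_idStr_left' (U : ι → Pauli) : strSign idStr U = 1 := by
  unfold strSign; exact Finset.prod_eq_one fun i _ => by cases U i <;> rfl

omit [DecidableEq ι] in
/-- `κ(a, a·U) = κ(a, U)`: multiplying a label by `a` does not change its commutation sign with `a`. [folklore] -/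
private theorem strSign_stringMul_self_right (a U : ι → Pauli) : strSign a (stringMul a U) = strSign a U := by
  rw [OTOC.strSign_comm, strSign_stringMul_left, strSign_self', one_mul, OTOC.strSign_comm]

/-! ## 2. One Clifford-angle letter is an involution on labels -/

omit [DecidableEq ι] in
/-- **The step is an involution**: `a ▸ (a ▸ U) = U` — a commuting `U` is fixed twice, an anticommuting `U` goes to
`a·U`, which still anticommutes with `a` and goes back to `a·a·U = U`.
[cite: RudolphEtAl2025, §II B eq. (14)] [cite: BegusicGrayChan2024, Results §Sparse Pauli dynamics] -/
theorem cliffStep_cliffStep (a U : ι → Pauli) : cliffStep a (cliffStep a U) = U := by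
  rcases OTOC.strSign_eq_one_or a U with h | h
  · have h1 : cliffStep a U = U := by rw [cliffStep, if_pos h]
    rw [h1, h1]
  · have hne : strSign a U ≠ 1 := by rw [h]; norm_num
    have h1 : cliffStep a U = stringMul a U := by rw [cliffStep, if_neg hne]
    have h2 : strSign a (stringMul a U) ≠ 1 := by rwa [strSign_stringMul_self_right]
    rw [h1, cliffStep, if_neg h2, stringMul_stringMul_self]

omit [DecidableEq ι] in
/-- Involution as a symmetric relation: `a ▸ U = S ↔ a ▸ S = U`. [cite: RudolphEtAl2025, §II B eq. (14)] -/
theorem cliffStep_eq_comm {a U S : ι → Pauli} : cliffStep a U = S ↔ cliffStep a S = U := by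
  constructor
  · rintro rfl; exact cliffStep_cliffStep a U
  · rintro rfl; exact cliffStep_cliffStep a S

omit [DecidableEq ι] in
/-- A step that MOVES `U` lands on a label anticommuting with `U` (`κ(a·U, U) = κ(a, U) = −1`).
[cite: RudolphEtAl2025, §II B eq. (14)] -/
theorem strSign_cliffStep_of_ne {a U : ι → Pauli} (h : cliffStep a U ≠ U) : strSign (cliffStep a U) U = -1 := by
  rcases OTOC.strSign_eq_one_or a U with h1 | h1
  · exact absurd (by rw [cliffStep, if_pos h1]) h
  · have hne : strSign a U ≠ 1 := by rw [h1]; norm_num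
    rw [cliffStep, if_neg hne, strSign_stringMul_left, strSign_self', mul_one, h1]

/-! ## 3. Letter families: words, walks, one-step and `L`-step counts -/

/-- The word of strings spelled by `w : Fin L → κ` over the letter family `P`. [cite: QuekEtAl2024, Methods §1.2] -/
def lword (P : κ → ι → Pauli) (L : ℕ) (w : Fin L → κ) : Fin L → ι → Pauli := fun j => P (w j)

/-- The rotation word `R_{P(w₀)}(π/2) ⋯ R_{P(w_{L−1})}(π/2)` of the letter family (`RotationWords.wordU` of the
spelled word). [cite: BegusicGrayChan2024, Results §Sparse Pauli dynamics] -/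
def lwordU (P : κ → ι → Pauli) (L : ℕ) (w : Fin L → κ) : Matrix (ι → Bool) (ι → Bool) ℂ :=
  wordU L (lword P L w)

/-- The label walk of the spelled word (`RotationWords.walk`). [cite: BegusicGrayChan2024, Results §Sparse Pauli
dynamics] -/
def lwalk (P : κ → ι → Pauli) (L : ℕ) (w : Fin L → κ) : (ι → Pauli) → ι → Pauli :=
  walk L (lword P L w)

/-- **One-step count** of the letter family: `lstep P U S = #{k : P k ▸ U = S}` (letters counted with
multiplicity). [cite: RudolphEtAl2025, §II B eq. (14)] -/
def lstep (P : κ → ι → Pauli) (U S : ι → Pauli) : ℝ := ∑ k : κ, if cliffStep (P k) U = S then 1 else 0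

/-- **`L`-step count**: the number of depth-`L` words carrying `T` to `S`. [cite: QuekEtAl2024, Methods §1.2
Definition 3] -/
def lcount (P : κ → ι → Pauli) (L : ℕ) (T S : ι → Pauli) : ℝ :=
  ∑ w : Fin L → κ, if lwalk P L w T = S then 1 else 0

omit [DecidableEq ι] in
/-- **Symmetry of the one-step count** (detailed balance with the uniform measure, for EVERY letter family):
`lstep P U S = lstep P S U`. [cite: LevinPeres2017, §1.6 (reversibility)] [cite: RudolphEtAl2025, §II B eq. (14)] -/
theorem lstep_comm (P : κ → ι → Pauli) (U S : ι → Pauli) : lstep P U S = lstep P S U := by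
  unfold lstep
  refine Finset.sum_congr rfl fun k _ => ?_
  by_cases h : cliffStep (P k) U = S
  · rw [if_pos h, if_pos (cliffStep_eq_comm.mp h)]
  · rw [if_neg h, if_neg (mt cliffStep_eq_comm.mpr h)]

/-- Row sums: every letter sends `U` somewhere, `Σ_S lstep P U S = |κ|`. [cite: RudolphEtAl2025, §II B eq. (14)] -/
theorem sum_lstep (P : κ → ι → Pauli) (U : ι → Pauli) : ∑ S, lstep P U S = Fintype.card κ := by
  unfold lstep
  rw [Finset.sum_comm]
  simp only [Finset.sum_ite_eq, Finset.mem_univ, if_true, Finset.sum_const, Finset.card_univ, nsmul_eq_mul, mul_one]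

omit [DecidableEq ι] in
/-- The identity label is never reached from a non-identity one. [cite: RudolphEtAl2025, §II B eq. (14)] -/
theorem lstep_idStr_right (P : κ → ι → Pauli) {U : ι → Pauli} (hU : U ≠ idStr) : lstep P U idStr = 0 :=
  Finset.sum_eq_zero fun k _ => if_neg (cliffStep_ne_idStr (P k) hU)

omit [DecidableEq ι] in
/-- **The zero of the kernel**: a label `S ≠ U` COMMUTING with `U` is unreachable from `U` in one step, whatever
the letters (a moving step lands on an anticommuting label). [cite: RudolphEtAl2025, §II B eq. (14)] -/
theorem lstep_eq_zero_of_comm (P : κ → ι → Pauli) {U S : ι → Pauli} (hne : S ≠ U) (hc : strSign S U = 1) :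
    lstep P U S = 0 := by
  refine Finset.sum_eq_zero fun k _ => if_neg fun h => ?_
  have h' := strSign_cliffStep_of_ne (a := P k) (U := U) (by rw [h]; exact hne)
  rw [h, hc] at h'
  norm_num at h'

omit [DecidableEq ι] in
/-- `lcount` is the cardinality of the fibre (the quantity the interface `IsCliffordMixingLayer.equi` fixes).
[cite: QuekEtAl2024, Methods §1.2 Definition 3] -/
theorem lcount_eq_card (P : κ → ι → Pauli) (L : ℕ) (T S : ι → Pauli) :
    lcount P L T S = ((Finset.univ.filter fun w : Fin L → κ => lwalk P L w T = S).card : ℝ) := by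
  rw [lcount, Finset.card_filter]; push_cast; rfl

omit [DecidableEq ι] in
/-- Depth zero: the single empty word fixes every label, `lcount P 0 T S = [T = S]` (`K⁰ = 1`).
[cite: LevinPeres2017, §1.1 (t-step transition probabilities are matrix powers; P⁰ = I)] -/
theorem lcount_zero (P : κ → ι → Pauli) (T S : ι → Pauli) : lcount P 0 T S = if T = S then 1 else 0 := by
  unfold lcount lwalk
  simp [walk]

/-- **The recursion** (append one letter): `lcount P (L+1) T S = Σ_U lcount P L T U · lstep P U S`.
[cite: BegusicGrayChan2024, Results §Sparse Pauli dynamics] -/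
theorem lcount_succ (P : κ → ι → Pauli) (L : ℕ) (T S : ι → Pauli) :
    lcount P (L + 1) T S = ∑ U : ι → Pauli, lcount P L T U * lstep P U S := by
  have key : ∀ w' : Fin L → κ,
      (∑ k : κ, if cliffStep (P k) (lwalk P L w' T) = S then (1 : ℝ) else 0) =
        ∑ U : ι → Pauli, (if lwalk P L w' T = U then (1 : ℝ) else 0) * lstep P U S := by
    intro w'
    simp only [ite_mul, one_mul, zero_mul]
    rw [Finset.sum_ite_eq Finset.univ (lwalk P L w' T), if_pos (Finset.mem_univ _)]
    rfl
  unfold lcount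
  rw [← (Fin.snocEquiv fun _ : Fin (L + 1) => κ).sum_comp, Fintype.sum_prod_type, Finset.sum_comm]
  have hw : ∀ (w' : Fin L → κ) (k : κ),
      lwalk P (L + 1) ((Fin.snocEquiv fun _ : Fin (L + 1) => κ) (k, w')) T = cliffStep (P k) (lwalk P L w' T) := by
    intro w' k
    unfold lwalk lword
    simp only [walk, Fin.snocEquiv_apply, Fin.snoc_last, Fin.snoc_castSucc]
  simp only [hw, key]
  rw [Finset.sum_comm]
  simp only [← Finset.sum_mul]

omit [DecidableEq ι] in
/-- A non-identity source never reaches the identity (`RotationWords.walk_ne_idStr` BY NAME).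
[cite: RudolphEtAl2025, §II B eq. (14)] -/
theorem lcount_idStr_right (P : κ → ι → Pauli) (L : ℕ) {T : ι → Pauli} (hT : T ≠ idStr) :
    lcount P L T idStr = 0 :=
  Finset.sum_eq_zero fun _ _ => if_neg (walk_ne_idStr L _ hT)

/-- Depth one is the one-step count (`K¹ = K`). [cite: LevinPeres2017, §1.1] [cite: RudolphEtAl2025, §II B eq. (14)] -/
theorem lcount_one (P : κ → ι → Pauli) (T S : ι → Pauli) : lcount P 1 T S = lstep P T S := by
  show lcount P (0 + 1) T S = _
  rw [lcount_succ]
  simp only [lcount_zero, ite_mul, one_mul, zero_mul, Finset.sum_ite_eq, Finset.mem_univ, if_true]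

/-! ## 4. The kernel on non-identity labels: `K = D + c·J` -/

/-- Sums over non-identity labels: total minus the identity term. [folklore] -/
private theorem sum_nonId (f : (ι → Pauli) → ℝ) :
    ∑ V : {S : ι → Pauli // S ≠ idStr}, f V.1 = (∑ V, f V) - f idStr := by
  rw [← Finset.sum_erase_eq_sub (f := f) (Finset.mem_univ idStr)]
  exact (Finset.sum_subtype (Finset.univ.erase idStr) (fun V => by simp) f).symm

/-- `#{S ≠ I} = 4ⁿ − 1` (naturals). [cite: QuekEtAl2024, Methods §1.2 Definition 3] -/
theorem card_nonId_nat : Fintype.card {S : ι → Pauli // S ≠ idStr} = 4 ^ Fintype.card ι - 1 := by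
  rw [Fintype.card_subtype_compl, Fintype.card_fun, Pauli.card_univ]
  simp

/-- `#{S ≠ I} = 4ⁿ − 1` (reals). [cite: QuekEtAl2024, Methods §1.2 Definition 3] -/
theorem card_nonId : (Fintype.card {S : ι → Pauli // S ≠ idStr} : ℝ) = (4 : ℝ) ^ Fintype.card ι - 1 := by
  rw [card_nonId_nat, Nat.cast_sub (Nat.one_le_pow _ _ (by norm_num)), Nat.cast_pow]; norm_num

omit [DecidableEq ι] in
/-- `4ⁿ − 1 > 0` on `n ≥ 1` wires. [folklore] -/
private theorem labels_pos [Nonempty ι] : 0 < (4 : ℝ) ^ Fintype.card ι - 1 :=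
  sub_pos.mpr (one_lt_pow₀ (by norm_num) Fintype.card_ne_zero)

/-- **The one-step kernel** on the `4ⁿ − 1` non-identity labels, `K_{U S} = lstep P U S`.
[cite: LevinPeres2017, §1.1 (transition matrix)] [cite: RudolphEtAl2025, §II B eq. (14)] -/
def kernel (P : κ → ι → Pauli) : Matrix {S : ι → Pauli // S ≠ idStr} {S : ι → Pauli // S ≠ idStr} ℝ :=
  Matrix.of fun U S => lstep P U.1 S.1

/-- The all-ones matrix `J` on non-identity labels (`J/(4ⁿ − 1)` = the projector onto constants, the stationary part of
a symmetric kernel). [cite: LevinPeres2017, §12.1] [cite: LyonsPeres2016, §6.2 and proof of Theorem 13.13] -/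
def ones : Matrix {S : ι → Pauli // S ≠ idStr} {S : ι → Pauli // S ≠ idStr} ℝ := Matrix.of fun _ _ => 1

omit [DecidableEq ι] in
/-- Entries of `K`. [folklore] -/
private theorem kernel_apply (P : κ → ι → Pauli) (U S : {S : ι → Pauli // S ≠ idStr}) : kernel P U S = lstep P U.1 S.1 :=
  rfl

omit [Fintype ι] [DecidableEq ι] in
/-- Entries of `c · J`. [folklore] -/
private theorem smul_ones_apply (c : ℝ) (U S : {S : ι → Pauli // S ≠ idStr}) :
    (c • (ones : Matrix {S : ι → Pauli // S ≠ idStr} {S : ι → Pauli // S ≠ idStr} ℝ)) U S = c := by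
  rw [Matrix.smul_apply, ones, Matrix.of_apply, smul_eq_mul, mul_one]

omit [Fintype ι] [DecidableEq ι] in
/-- `Jᵀ = J`. [folklore] -/
private theorem ones_transpose : (ones : Matrix {S : ι → Pauli // S ≠ idStr} {S : ι → Pauli // S ≠ idStr} ℝ)ᵀ = ones :=
  rfl

omit [DecidableEq ι] in
/-- **`K` is symmetric** for every letter family (a reversible chain w.r.t. the uniform measure).
[cite: LevinPeres2017, §1.6 (reversibility)] [cite: LyonsPeres2016, §6.2 and proof of Theorem 13.13 (P self-adjoint on ℓ²(π))] -/
theorem kernel_transpose (P : κ → ι → Pauli) : (kernel P)ᵀ = kernel P := by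
  ext U S; rw [Matrix.transpose_apply, kernel_apply, kernel_apply, lstep_comm]

/-- `K J = |κ| J` (row sums, the identity label being isolated). [cite: LevinPeres2017, §1.5 (stationary
distributions)] -/
theorem kernel_mul_ones (P : κ → ι → Pauli) : kernel P * ones = (Fintype.card κ : ℝ) • ones := by
  ext U S
  rw [Matrix.mul_apply, smul_ones_apply]
  simp only [kernel_apply, ones, Matrix.of_apply, mul_one]
  have h := sum_nonId (ι := ι) fun V => lstep P U.1 V
  rw [h, sum_lstep, lstep_idStr_right P U.2, sub_zero]

/-- `J K = |κ| J` (column sums, by symmetry). [cite: LevinPeres2017, §1.6 (reversible chains)] -/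
theorem ones_mul_kernel (P : κ → ι → Pauli) : ones * kernel P = (Fintype.card κ : ℝ) • ones := by
  have h := congrArg Matrix.transpose (kernel_mul_ones P)
  rw [Matrix.transpose_mul, kernel_transpose, ones_transpose, Matrix.transpose_smul, ones_transpose] at h
  exact h

/-- `J J = (4ⁿ − 1) J`. [folklore] -/
private theorem ones_mul_ones :
    (ones : Matrix {S : ι → Pauli // S ≠ idStr} {S : ι → Pauli // S ≠ idStr} ℝ) * ones =
      ((4 : ℝ) ^ Fintype.card ι - 1) • ones := by
  ext U S
  rw [Matrix.mul_apply, smul_ones_apply]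
  simp only [ones, Matrix.of_apply, mul_one, Finset.sum_const, Finset.card_univ, nsmul_eq_mul, card_nonId]

/-- **Word counts are kernel powers**: `(K^L)_{U S} = lcount P L U S` for every `L` (at `L = 0` both sides are
`[U = S]`: `K⁰ = 1` and the empty word). [cite: LevinPeres2017, §1.1 (t-step transition probabilities are matrix
powers)] [cite: QuekEtAl2024, Methods §1.2 Definition 3] -/
theorem kernel_pow_apply (P : κ → ι → Pauli) : ∀ (L : ℕ) (U S : {S : ι → Pauli // S ≠ idStr}),
    (kernel P ^ L) U S = lcount P L U.1 S.1 := by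
  intro L
  induction L with
  | zero =>
    intro U S
    rw [pow_zero, Matrix.one_apply, lcount_zero]
    by_cases h : U = S
    · rw [if_pos h, if_pos (congrArg Subtype.val h)]
    · rw [if_neg h, if_neg fun h' => h (Subtype.ext h')]
  | succ L ih =>
    intro U S
    rw [pow_succ, Matrix.mul_apply, lcount_succ]
    simp only [ih, kernel_apply]
    have h := sum_nonId (ι := ι) fun V => lcount P L U.1 V * lstep P V S.1
    rw [h, lcount_idStr_right P L U.2, zero_mul, sub_zero]

/-- **The defect** `D = K − (|κ|/(4ⁿ − 1)) J`: the kernel minus its flat part. [cite: LevinPeres2017, §12.1] -/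
def defect (P : κ → ι → Pauli) : Matrix {S : ι → Pauli // S ≠ idStr} {S : ι → Pauli // S ≠ idStr} ℝ :=
  kernel P - ((Fintype.card κ : ℝ) / ((4 : ℝ) ^ Fintype.card ι - 1)) • ones

omit [DecidableEq ι] in
/-- `K = D + cJ`. [folklore] -/
private theorem kernel_eq_defect_add (P : κ → ι → Pauli) :
    kernel P = defect P + ((Fintype.card κ : ℝ) / ((4 : ℝ) ^ Fintype.card ι - 1)) • ones :=
  (sub_add_cancel _ _).symm

omit [DecidableEq ι] in
/-- `D` is symmetric. [cite: LevinPeres2017, §12.1] -/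
theorem defect_transpose (P : κ → ι → Pauli) : (defect P)ᵀ = defect P := by
  rw [defect, Matrix.transpose_sub, Matrix.transpose_smul, kernel_transpose, ones_transpose]

/-- `D J = 0` (on `n ≥ 1` wires, where `4ⁿ − 1 ≠ 0`). [cite: LevinPeres2017, §12.1] -/
theorem defect_mul_ones [Nonempty ι] (P : κ → ι → Pauli) : defect P * ones = 0 := by
  rw [defect, sub_mul, Matrix.smul_mul, kernel_mul_ones, ones_mul_ones, smul_smul, ← sub_smul,
    div_mul_cancel₀ _ (labels_pos (ι := ι)).ne', sub_self, zero_smul]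

/-- `J D = 0`. [cite: LevinPeres2017, §12.1] -/
theorem ones_mul_defect [Nonempty ι] (P : κ → ι → Pauli) : ones * defect P = 0 := by
  have h := congrArg Matrix.transpose (defect_mul_ones P)
  rwa [Matrix.transpose_mul, defect_transpose, ones_transpose, Matrix.transpose_zero] at h

/-- **The cross terms die**: `K^{L+1} = D^{L+1} + (|κ|^{L+1}/(4ⁿ − 1)) J`. [cite: LevinPeres2017, §12.1 (spectral
representation of a reversible transition matrix)] -/
theorem kernel_pow_succ [Nonempty ι] (P : κ → ι → Pauli) : ∀ L : ℕ,
    kernel P ^ (L + 1) = defect P ^ (L + 1) +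
      ((Fintype.card κ : ℝ) ^ (L + 1) / ((4 : ℝ) ^ Fintype.card ι - 1)) • ones := by
  intro L
  induction L with
  | zero => rw [zero_add, pow_one, pow_one, pow_one]; exact kernel_eq_defect_add P
  | succ L ih =>
    have hN : (4 : ℝ) ^ Fintype.card ι - 1 ≠ 0 := (labels_pos (ι := ι)).ne'
    have hDJ : defect P ^ (L + 1) * ones = 0 := by
      rw [pow_succ, Matrix.mul_assoc, defect_mul_ones, Matrix.mul_zero]
    have hcoef : (Fintype.card κ : ℝ) ^ (L + 1) / ((4 : ℝ) ^ Fintype.card ι - 1) *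
        ((Fintype.card κ : ℝ) / ((4 : ℝ) ^ Fintype.card ι - 1)) * ((4 : ℝ) ^ Fintype.card ι - 1) =
          (Fintype.card κ : ℝ) ^ (L + 1 + 1) / ((4 : ℝ) ^ Fintype.card ι - 1) := by
      field_simp; ring
    rw [pow_succ, ih, kernel_eq_defect_add P, Matrix.add_mul, Matrix.mul_add, Matrix.mul_add, Matrix.mul_smul,
      hDJ, smul_zero, add_zero, Matrix.smul_mul, Matrix.smul_mul, ones_mul_defect, smul_zero, zero_add,
      Matrix.mul_smul, ones_mul_ones, smul_smul, smul_smul, ← pow_succ, hcoef]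

/-- Trace-of-square step: a real symmetric `D` with `D^{2k} = 0` has `D^k = 0` (the diagonal of `(D^k)ᵀ D^k` is a
sum of squares). [folklore] -/
private theorem pow_eq_zero_of_pow_two_mul_eq_zero {m : Type*} [Fintype m] [DecidableEq m] {D : Matrix m m ℝ}
    (hD : Dᵀ = D) (k : ℕ) (h : D ^ (2 * k) = 0) : D ^ k = 0 := by
  have h2 : (D ^ k)ᵀ * D ^ k = 0 := by rw [Matrix.transpose_pow, hD, ← pow_add, ← two_mul, h]
  ext i j
  have hjj := congrFun (congrFun h2 j) j
  rw [Matrix.mul_apply, Matrix.zero_apply] at hjj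
  simp only [Matrix.transpose_apply] at hjj
  rw [Matrix.zero_apply]
  exact mul_self_eq_zero.mp
    ((Finset.sum_eq_zero_iff_of_nonneg fun l _ => mul_self_nonneg ((D ^ k) l j)).mp hjj i (Finset.mem_univ i))

/-- **A real symmetric nilpotent matrix vanishes**: `Dᵀ = D`, `D^{L+1} = 0 ⟹ D = 0`, by halving descent on the
exponent.  Elementary twin of the spectral statement (a self-adjoint operator has an orthogonal eigenbasis with real
eigenvalues, and `λ^{L+1} = 0 ⟹ λ = 0`); the tree's `HornJohnson2013…DiagonalizabilityTests.isNilpotent_iff_eq_zero`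
(needs an explicit diagonalisation) and `Andre1996.PositiveInvolutionSemisimple.eq_zero_of_isNilpotent_mul_star`
(cyclic definite trace form on a star-algebra) are NOT used verbatim: import discipline and hypothesis shape.
[folklore] -/
private theorem eq_zero_of_transpose_eq_of_pow_eq_zero {m : Type*} [Fintype m] [DecidableEq m]
    {D : Matrix m m ℝ} (hD : Dᵀ = D) : ∀ L : ℕ, D ^ (L + 1) = 0 → D = 0 := by
  intro L
  induction L using Nat.strong_induction_on with
  | h L ih =>
    intro h
    rcases Nat.eq_zero_or_pos L with hL | hL
    · rw [hL, zero_add, pow_one] at h; exact h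
    · have h2k : L + 1 ≤ 2 * (L / 2 + 1) := by omega
      have hpow : D ^ (2 * (L / 2 + 1)) = 0 := by
        rw [← Nat.add_sub_cancel' h2k, pow_add, h, zero_mul]
      exact ih (L / 2) (by omega) (pow_eq_zero_of_pow_two_mul_eq_zero hD (L / 2 + 1) hpow)

/-- **ALL-OR-NOTHING FOR THE KERNEL**: `K^{L+1}` is flat (`= (|κ|^{L+1}/(4ⁿ − 1)) J`) iff `K` itself is flat
(`= (|κ|/(4ⁿ − 1)) J`) — a symmetric chain exactly stationary after `L + 1` steps is stationary after one.
[cite: LevinPeres2017, §12.1 (spectral representation of a reversible transition matrix)] [cite: LyonsPeres2016,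
§6.2 and proof of Theorem 13.13 (self-adjointness, real eigenvalues)] -/
theorem kernel_pow_eq_iff [Nonempty ι] (P : κ → ι → Pauli) (L : ℕ) :
    kernel P ^ (L + 1) = ((Fintype.card κ : ℝ) ^ (L + 1) / ((4 : ℝ) ^ Fintype.card ι - 1)) • ones ↔
      kernel P = ((Fintype.card κ : ℝ) / ((4 : ℝ) ^ Fintype.card ι - 1)) • ones := by
  rw [kernel_pow_succ]
  have hK := kernel_eq_defect_add P
  constructor
  · intro h
    have hD : defect P ^ (L + 1) = 0 := add_right_cancel (h.trans (zero_add _).symm)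
    rw [hK, eq_zero_of_transpose_eq_of_pow_eq_zero (defect_transpose P) L hD, zero_add]
  · intro h
    rw [hK] at h
    have hD0 : defect P = 0 := add_right_cancel (h.trans (zero_add _).symm)
    rw [hD0, zero_pow (Nat.succ_ne_zero L), zero_add]

/-! ## 5. Bridge to the interface `IsCliffordMixingLayer` -/

/-- The interface at depth `L` for the letter-word ensemble ⟺ every fibre count is `|κ|^L/(4ⁿ − 1)` (the three
other fields — unitarity, Clifford conjugation, non-identity — hold for every word by `RotationWords.wordU_mul_conjTranspose`,
`wordU_conj`, `walk_ne_idStr` BY NAME). [cite: QuekEtAl2024, Methods §1.2 Definition 3] -/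
theorem isCliffordMixingLayer_iff_lcount (P : κ → ι → Pauli) (L : ℕ) :
    IsCliffordMixingLayer (lwordU P L) (lwalk P L) ↔
      ∀ S T : ι → Pauli, S ≠ idStr → T ≠ idStr →
        lcount P L T S = (Fintype.card κ : ℝ) ^ L / ((4 : ℝ) ^ Fintype.card ι - 1) := by
  have hcard : (Fintype.card (Fin L → κ) : ℝ) = (Fintype.card κ : ℝ) ^ L := by
    rw [Fintype.card_fun, Fintype.card_fin, Nat.cast_pow]
  constructor
  · intro h S T hS hT
    rw [lcount_eq_card, h.equi S T hS hT, hcard]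
  · intro h
    exact
      { unitary := fun w => wordU_mul_conjTranspose L (lword P L w)
        conj := fun w T => ⟨wordPhase L (lword P L w) T, norm_wordPhase L _ T, wordU_conj L _ T⟩
        nonId := fun w T hT => walk_ne_idStr L _ hT
        equi := fun S T hS hT => by rw [← lcount_eq_card, h S T hS hT, hcard] }

/-- Constant fibre counts ⟺ flat kernel power. [cite: LevinPeres2017, §1.1] [cite: QuekEtAl2024, Methods §1.2
Definition 3] -/
theorem lcount_const_iff_kernel_pow (P : κ → ι → Pauli) (L : ℕ) (c : ℝ) :
    (∀ S T : ι → Pauli, S ≠ idStr → T ≠ idStr → lcount P L T S = c) ↔ kernel P ^ L = c • ones := by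
  constructor
  · intro h; ext U S; rw [kernel_pow_apply, smul_ones_apply]; exact h S.1 U.1 S.2 U.2
  · intro h S T hS hT
    have h' := congrFun (congrFun h ⟨T, hT⟩) ⟨S, hS⟩
    rwa [kernel_pow_apply, smul_ones_apply] at h'

/-! ## 6. The records -/

/-- **EXACT MIXING IS ALL-OR-NOTHING IN THE DEPTH** (i.i.d. letters, `n ≥ 1` wires): the rotation-word ensemble of
a letter family is exactly Clifford–Pauli mixing at depth `L + 1` iff it is at depth `1`.  HONEST SCOPE: one
family `P` at every position (position-dependent letter laws NOT treated); angle `π/2`; «exact» = the `equi`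
count; nothing on approximate rates; no design / state / noise / sampler / hardness statement.
[cite: LevinPeres2017, §12.1] [cite: QuekEtAl2024, Methods §1.2 Definition 3] -/
theorem isCliffordMixingLayer_iff_depth_one [Nonempty ι] (P : κ → ι → Pauli) (L : ℕ) :
    IsCliffordMixingLayer (lwordU P (L + 1)) (lwalk P (L + 1)) ↔
      IsCliffordMixingLayer (lwordU P 1) (lwalk P 1) := by
  rw [isCliffordMixingLayer_iff_lcount, isCliffordMixingLayer_iff_lcount, lcount_const_iff_kernel_pow,
    lcount_const_iff_kernel_pow, pow_one, pow_one, kernel_pow_eq_iff]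

/-- **Depth one, spelled out**: exact at depth `1` iff the one-step count is flat, `lstep P U S = |κ|/(4ⁿ − 1)` for
all non-identity `U, S`. [cite: QuekEtAl2024, Methods §1.2 Definition 3] [cite: RudolphEtAl2025, §II B eq. (14)] -/
theorem isCliffordMixingLayer_one_iff (P : κ → ι → Pauli) :
    IsCliffordMixingLayer (lwordU P 1) (lwalk P 1) ↔
      ∀ U S : ι → Pauli, U ≠ idStr → S ≠ idStr →
        lstep P U S = (Fintype.card κ : ℝ) / ((4 : ℝ) ^ Fintype.card ι - 1) := by
  rw [isCliffordMixingLayer_iff_lcount, pow_one]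
  constructor
  · intro h U S hU hS; rw [← lcount_one]; exact h S U hS hU
  · intro h S T hS hT; rw [lcount_one]; exact h T S hT hS

/-- Two commuting, distinct, non-identity labels on `n ≥ 2` wires: `X` on wire `i₀` and `X` on wire `i₁`.
[cite: KempeEtAl2010, §2 Observation 4 (commutation table)] -/
private theorem exists_comm_pair (hn : 1 < Fintype.card ι) :
    ∃ U S : ι → Pauli, U ≠ idStr ∧ S ≠ idStr ∧ S ≠ U ∧ strSign S U = 1 := by
  obtain ⟨i₀, i₁, hne⟩ := Fintype.exists_pair_of_one_lt_card hn
  refine ⟨Function.update idStr i₀ Pauli.X, Function.update idStr i₁ Pauli.X, ?_, ?_, ?_, ?_⟩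
  · intro h; simpa [idStr] using congrFun h i₀
  · intro h; simpa [idStr] using congrFun h i₁
  · intro h; simpa [idStr, Function.update_apply, hne.symm] using congrFun h i₁
  · unfold strSign
    refine Finset.prod_eq_one fun i _ => ?_
    simp only [Function.update_apply, idStr]
    split_ifs <;> simp [Pauli.sign]

/-- **NO LETTER LAW IS EXACTLY MIXING ON `n ≥ 2` WIRES, AT ANY DEPTH** (incl. `L = 0`, where the single empty word
fixes every label while the interface asks for `1/(4ⁿ − 1)` of it between two distinct labels): at depth `L + 1`
the all-or-nothing law reduces to depth `1`, where the commuting pair `(X_{i₀}, X_{i₁})` has `lstep = 0 ≠ |κ|/(4ⁿ − 1)`.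
Covers every `|κ|` and `L`, in particular those with `(4ⁿ − 1) ∣ |κ|^L`, where the divisibility test
`RotationWords.dvd_card_of_isCliffordMixingLayer` is silent.  HONEST SCOPE as in `isCliffordMixingLayer_iff_depth_one`;
the Clifford group is untouched. [cite: QuekEtAl2024, Methods §1.2 Definition 3] [cite: ZhuEtAl2016, §1]
[cite: LevinPeres2017, §12.1] -/
theorem not_isCliffordMixingLayer_letterWords (hn : 1 < Fintype.card ι) [Nonempty κ] (P : κ → ι → Pauli) :
    ∀ L : ℕ, ¬ IsCliffordMixingLayer (lwordU P L) (lwalk P L) := by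
  haveI : Nonempty ι := Fintype.card_pos_iff.mp (by omega)
  have hN : 0 < (4 : ℝ) ^ Fintype.card ι - 1 := labels_pos
  obtain ⟨U, S, hU, hS, hSU, hc⟩ := exists_comm_pair hn
  intro L hL
  cases L with
  | zero =>
    have h := (isCliffordMixingLayer_iff_lcount P 0).mp hL S U hS hU
    rw [lcount_zero, if_neg (Ne.symm hSU), pow_zero] at h
    have h1 : (0 : ℝ) < 1 / ((4 : ℝ) ^ Fintype.card ι - 1) := div_pos one_pos hN
    linarith
  | succ L =>
    have h := (isCliffordMixingLayer_one_iff P).mp ((isCliffordMixingLayer_iff_depth_one P L).mp hL) U S hU hS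
    rw [lstep_eq_zero_of_comm P hSU hc] at h
    have hk : (0 : ℝ) < Fintype.card κ := Nat.cast_pos.mpr Fintype.card_pos
    have h1 : (0 : ℝ) < (Fintype.card κ : ℝ) / ((4 : ℝ) ^ Fintype.card ι - 1) := div_pos hk hN
    linarith

/-- **The interface's permutation is forced**: if the letter-word ensemble is exactly mixing with respect to SOME
label map `π`, then `π` is the label walk (compare the two conjugation identities and take the trace against
`σ_{π w T}`, `PauliParseval.trace_pauliString_mul_pauliString` BY NAME). [cite: QuekEtAl2024, Methods §1.2
Definition 3] [cite: BegusicGrayChan2024, Results §Sparse Pauli dynamics] -/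
theorem perm_eq_lwalk {P : κ → ι → Pauli} {L : ℕ} {π : (Fin L → κ) → (ι → Pauli) → ι → Pauli}
    (h : IsCliffordMixingLayer (lwordU P L) π) (w : Fin L → κ) (T : ι → Pauli) : π w T = lwalk P L w T := by
  obtain ⟨ε, hε, hconj⟩ := h.conj w T
  have h2 : (lwordU P L w)ᴴ * pauliString T * lwordU P L w =
      wordPhase L (lword P L w) T • pauliString (lwalk P L w T) := wordU_conj L _ T
  rw [hconj] at h2
  by_contra hne
  have htr := congrArg (fun M => (M * pauliString (π w T)).trace) h2
  simp only [Matrix.smul_mul, Matrix.trace_smul, trace_pauliString_mul_pauliString, if_neg (Ne.symm hne),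
    smul_eq_mul, mul_zero] at htr
  have hε0 : ε ≠ 0 := fun h0 => by rw [h0, norm_zero] at hε; exact zero_ne_one hε
  exact mul_ne_zero hε0 (pow_ne_zero _ two_ne_zero) htr

/-- … hence on `n ≥ 2` wires the letter-word ensemble is not exactly mixing with respect to ANY label map.
[cite: QuekEtAl2024, Methods §1.2 Definition 3] [cite: ZhuEtAl2016, §1] -/
theorem not_isCliffordMixingLayer_letterWords_perm (hn : 1 < Fintype.card ι) [Nonempty κ] (P : κ → ι → Pauli)
    (L : ℕ) (π : (Fin L → κ) → (ι → Pauli) → ι → Pauli) : ¬ IsCliffordMixingLayer (lwordU P L) π := by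
  intro h
  have hπ : π = lwalk P L := funext fun w => funext fun T => perm_eq_lwalk h w T
  subst hπ
  exact not_isCliffordMixingLayer_letterWords hn P L h

/-- `RotationWords.not_isCliffordMixingLayer_words` RECOVERED (not restated) on `n ≥ 2` wires by the second route:
the uniform letter law (`P = id`, all `4ⁿ` strings) is one letter family. [cite: ZhuEtAl2016, §1] [cite:
QuekEtAl2024, Methods §1.2 Definition 3] -/
theorem words_not_isCliffordMixingLayer_of_one_lt (hn : 1 < Fintype.card ι) (L : ℕ) :
    ¬ IsCliffordMixingLayer (fun w : Fin L → ι → Pauli => wordU L w) fun w => walk L w :=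
  not_isCliffordMixingLayer_letterWords hn (fun a : ι → Pauli => a) L

/-! ## 7. One wire: the exact inhabitant `{R_X, R_Y, R_Z}`; two wires: divisibility is silent -/

/-- The letter family of ALL non-identity strings (on one wire: the three letters `X, Y, Z`).
[cite: QuekEtAl2024, Methods §1.2] -/
def nonIdLetters : {S : ι → Pauli // S ≠ idStr} → ι → Pauli := fun a => a.1

/-- Its one-step count = the uniform one (`RotationWords.stepCount_eq` BY NAME) minus the identity letter, which
fixes everything: `lstep = (4ⁿ/2 − 1)[S = U] + [κ(S,U) = −1]`. [cite: RudolphEtAl2025, §II B eq. (14)] -/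
theorem lstep_nonIdLetters {S : ι → Pauli} (hS : S ≠ idStr) (U : ι → Pauli) :
    lstep (nonIdLetters (ι := ι)) U S =
      (if S = U then (4 : ℝ) ^ Fintype.card ι / 2 - 1 else 0) + antiInd S U := by
  have h := sum_nonId (ι := ι) fun a => if cliffStep a U = S then (1 : ℝ) else 0
  have hI : cliffStep idStr U = U := by rw [cliffStep, if_pos (strSign_idStr_left' U)]
  have hsc : stepCount U S = ∑ a : ι → Pauli, if cliffStep a U = S then (1 : ℝ) else 0 := rfl
  show (∑ k : {S : ι → Pauli // S ≠ idStr}, if cliffStep k.1 U = S then (1 : ℝ) else 0) = _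
  rw [h, hI, ← hsc, stepCount_eq hS U]
  by_cases hSU : S = U
  · rw [if_pos hSU, if_pos hSU.symm, if_pos hSU]; ring
  · rw [if_neg hSU, if_neg (Ne.symm hSU), if_neg hSU]; ring

omit [DecidableEq ι] in
/-- On ONE wire two distinct non-identity letters anticommute. [cite: KempeEtAl2010, §2 Observation 4] -/
private theorem antiInd_eq_one_of_card_eq_one (h1 : Fintype.card ι = 1) {S U : ι → Pauli} (hS : S ≠ idStr)
    (hU : U ≠ idStr) (hSU : S ≠ U) : antiInd S U = 1 := by
  obtain ⟨i₀, hi₀⟩ := Fintype.card_eq_one_iff.mp h1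
  have hfun : ∀ T : ι → Pauli, T = fun _ => T i₀ := fun T => funext fun i => by rw [hi₀ i]
  have hs : strSign S U = Pauli.sign (S i₀) (U i₀) := by
    unfold strSign
    exact Finset.prod_eq_single i₀ (fun i _ hi => absurd (hi₀ i) hi) fun hi => absurd (Finset.mem_univ _) hi
  have hS0 : S i₀ ≠ Pauli.I := fun h => hS ((hfun S).trans (funext fun _ => h))
  have hU0 : U i₀ ≠ Pauli.I := fun h => hU ((hfun U).trans (funext fun _ => h))
  have hne : S i₀ ≠ U i₀ := fun h => hSU ((hfun S).trans ((funext fun _ => h).trans (hfun U).symm))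
  have hsg : Pauli.sign (S i₀) (U i₀) = -1 := by
    unfold Pauli.sign
    rw [if_neg (by rintro (h | h | h); exacts [hS0 h, hU0 h, hne h])]
  unfold antiInd
  rw [hs, hsg, if_pos rfl]

/-- On one wire the `{X, Y, Z}` kernel is FLAT: `lstep = 1 = 3/3` for all non-identity `U, S`.
[cite: RudolphEtAl2025, §II B eq. (14)] -/
theorem lstep_nonIdLetters_of_card_eq_one (h1 : Fintype.card ι = 1) {U S : ι → Pauli} (hU : U ≠ idStr)
    (hS : S ≠ idStr) : lstep (nonIdLetters (ι := ι)) U S = 1 := by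
  rw [lstep_nonIdLetters hS, h1, pow_one]
  by_cases hSU : S = U
  · subst hSU
    have h0 : antiInd S S = 0 := by
      unfold antiInd; rw [strSign_self', if_neg (by norm_num)]
    rw [if_pos rfl, h0]; norm_num
  · rw [if_neg hSU, antiInd_eq_one_of_card_eq_one h1 hS hU hSU]; norm_num

/-- **THE ONE-WIRE INHABITANT**: the three Clifford-angle rotations `R_X(π/2), R_Y(π/2), R_Z(π/2)` and all their
`3^{L+1}` words of any fixed depth `L + 1 ≥ 1` form an EXACTLY Clifford–Pauli-mixing ensemble on one wire (every
pair of non-identity labels joined by exactly `3^L` words).  At depth `0` nothing is mixing (`not` covered: the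
empty word).  [cite: QuekEtAl2024, Methods §1.2 Definition 3] [cite: RudolphEtAl2025, §II B eq. (14)] -/
theorem nonIdLetters_isCliffordMixingLayer (h1 : Fintype.card ι = 1) (L : ℕ) :
    IsCliffordMixingLayer (lwordU (nonIdLetters (ι := ι)) (L + 1)) (lwalk nonIdLetters (L + 1)) := by
  haveI : Nonempty ι := Fintype.card_pos_iff.mp (by omega)
  rw [isCliffordMixingLayer_iff_depth_one, isCliffordMixingLayer_one_iff]
  intro U S hU hS
  rw [lstep_nonIdLetters_of_card_eq_one h1 hU hS, card_nonId, h1]; norm_num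

/-- **NUMBERS, two wires**: the `15` non-identity letters give `|κ|^{L+1} = 15^{L+1}`, divisible by `4² − 1 = 15`
— the divisibility test of `RotationWords.dvd_card_of_isCliffordMixingLayer` is SILENT — and the ensemble is still
not exactly mixing at any depth `L + 1` (nor at depth `0`). [cite: ZhuEtAl2016, §1] [cite: QuekEtAl2024, Methods
§1.2 Definition 3] -/
theorem numbers_two (h2 : Fintype.card ι = 2) (L : ℕ) :
    Fintype.card {S : ι → Pauli // S ≠ idStr} = 15 ∧
      15 ∣ Fintype.card (Fin (L + 1) → {S : ι → Pauli // S ≠ idStr}) ∧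
      ¬ IsCliffordMixingLayer (lwordU (nonIdLetters (ι := ι)) (L + 1)) (lwalk nonIdLetters (L + 1)) := by
  have hc : Fintype.card {S : ι → Pauli // S ≠ idStr} = 15 := by rw [card_nonId_nat, h2]; norm_num
  haveI : Nonempty {S : ι → Pauli // S ≠ idStr} := Fintype.card_pos_iff.mp (by omega)
  refine ⟨hc, ?_, not_isCliffordMixingLayer_letterWords (by omega) _ (L + 1)⟩
  rw [Fintype.card_fun, Fintype.card_fin, hc]
  exact dvd_pow_self 15 (Nat.succ_ne_zero L)

end PauliMixingPurity.RotationWords.LetterLaw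

end Literature.Computability.QuantumComplexity
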